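import Literature.MathematicalPhysics.QuantumFieldTheory.Balaban1983to89.Node00.CarriersB10
import Summits.QuantumFields.Balaban3D.Proofs.Step0Tower
import Summits.QuantumFields.Balaban3D.Proofs.ScalesArithmetic

/-!
# BalabanUVNodes ∕ N08 — [Balaban1985UV3] Thm 2 ((41), (47)) AT THE RUNS OF RECORD: the LEVEL-0 STOREY of the per-run data at the record's
# binders, and the Sect.-D strength of the record's Thm-2 conjunct run by run

Track A, DAG node N08 = T. Bałaban, CMP **102** (1985) 255–275 [Balaban1985UV3]: Thm 2 p. 272 ((41) p. 266, (47) p. 267), Thm 1 p. 257 ((5)),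
(1) p. 256 «ρ₀(U) = exp[−(1/g₀²)A(U) − E]», (4) p. 256 «|U(∂p) − 1| < ε₁», (7) p. 257 «ε₁ = g₀p(g₀), p(g) = b₀(1 + log g⁻¹)^{p₀}», (5) p. 256
L35–36 «U_k(U) is the minimal configuration constructed in [7]» ([7] = [Balaban1985Variational] Thm 1 p. 279, class (2) p. 278).  Cell `pub-ymgap`,
width seat `pub-ymgap-dag-n08-w1` (D-0149, director-ym №197), W-SEAT-START-LIST §n08 item 1; `--supports` K1⁷ `StabilityBAtRecordR13SepCoPH` (helper).

CURRENCY.  At a NODE 00 record the `b10` leaf is `Node00.PrintedUV3V N L = ∃ 𝔗, PrintedUV3G N L (runObjects₀T N 𝔗 (Backgrounds.ofPrint N L))`,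
`PrintedUV3G N L R₀ = ∃ c, c.Adm ∧ Thm1PrintedCompact (runsAtG N R₀ c) ∧ Thm2Printed (runsAtG N R₀ c)` (`B10RunsOfRecord` §7–§9′, `Node00.CarriersB10`).
Seat n08-e PROVED (`BalabanUVNodesN08RelativeTo5.thm2Printed_runsAtG_iff_perRun`) that the Thm-2 conjunct IS «per-run data»: for every lattice
approximation `S`, tower objects `W : SectB.TowerObjects S (SU N)` with `W.toRunObjects = R₀ c S` whose pinned tower run carries a
`B10Assembly.LeafSystem`.  This file opens that datum at its first storey and records what the conjunct already contains.

WHAT THIS FILE PROVES (kernel; theorems only, 0 def ∕ 0 instance; nothing of the paper asserted).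
* §1 PRINT'S BACKGROUNDS OF RECORD AT LEVEL 0.  The record's binders take `U_k := UkA N 𝔞 S k εbg` (def-B's `Classical.choose` idiom along an
  averaging `𝔞`; `𝔞 := avOfPrint N` is `Uk3` ∕ `Backgrounds.ofPrint`).  Since `Averaging.iter 𝔞 0 = id` the level-0 problem is solvable iff `V` lies
  in [7]'s class, and **`U₀(V) = V` ON `PlaqSmall (εbg·η₀²)`, `U₀(V) = 1` OFF it** (`isBackground_zero_iff`, `ukExistsA_zero_iff`, `ukA_zero_of_plaqSmall`,
  `ukA_zero_of_not_plaqSmall`, the `Uk3` instances, `ukA_zero_ne_self`) — NOT the identity: the d = 3 lane's ruling R-K0 has `ukAll 0 = id` and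
  `Balaban3D.Proofs.Step0Tower.step0_towerObjects` takes `hU0 : ∀ V, W.Uk 0 V = V`, which FAILS at the record's binders off the class.
* §2 (41)₀ AND (47)₀ FOR ANY TOWER OBJECTS EXTENDING THE RECORD'S BINDERS `runObjects₀A N 𝔞 𝔗 (Backgrounds.ofAvg N L 𝔞) c S` with print's k = 0
  interaction data ((43) at k = 0, `Pint 0 ≡ 0` = `LeafSystem.noInt0`): `rho_pin_zero` ((1) on the pinned run, no hypothesis on `U₀`);
  **(41)₀ for every configuration** once the k = 0 history functional dominates its trivial-history term (`ineq41_zero`; off the class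
  `A(U₀(V)) = A(1) = 0 ≤ A(V)`); **(47)₀ ⟺ every NON-FLAT configuration of the (4)-window `PlaqSmall (ε₁ 0)` lies in [7]'s class at level 0**
  (`ineq47_zero_iff_window`), hence `step0_of_window : B10.Step0Printed W.pin.toTowerRun`.  The window is a LOCATED side condition on the ∃-constants
  `c` (print's (7) `ε₁(0) = g₀p(g₀)` vs [7]'s radius `εbg`), NOT a clause of `Consts.Adm`; print never meets it ((1) has no `U₀`).
* §3 THE WINDOW FROM THE CONSTANTS: `g·p(g) ≤ b₀·p₀^{p₀}·e^{1−p₀}` on (0, 1] (`mul_pFun_le`) and `g₀ ≤ 1` along the family (`Scales.gK_le_one`), so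
  **`b₀·p₀^{p₀}·e^{1−p₀} ≤ εbg` gives the window, hence (41)₀ ∧ (47)₀, at EVERY member of the family** (`window_of_consts`, `step0_of_consts`;
  inhabited: `exists_consts_adm_window`) — arranged once by the supplier's choice of `c`.
* §4 THE CONJUNCT'S STRENGTH: per-run data give (5) in the compact reading RUN BY RUN (`thm1Compact_single_of_leafSystem`, by
  `B10Assembly.thm1Compact_and_thm2_of_leafSystem` on the one-member family), so **the record's Thm-2 conjunct alone implies Thm 1 (compact reading)
  for each run separately** (`thm1Compact_single_of_thm2Printed_runsAtG`); only the UNIFORMITY of the O(1) (p. 257 L1) is left to the Thm-1 conjunct.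
* §5 the instances at the slot of record (`𝔞 := avOfPrint N`, `Backgrounds.ofPrint`, any version `𝔗 : TFamily₃ N L`, e.g. def-T's `tOfRecord₃ N L`).

HONEST FRAMING: count-neutral helper; N08 NOT discharged; `PrintedUV3V` ∕ Thm 2 at the record NOT proved (the per-run cluster-expansion data for
`k ≥ 1` = N08's object gap, class II of n08-b's `N08-ALPHA-ROWS.md`); one finite 𝕋⁴ programme at fixed ε with the d = 3 lattices of [B10] inside the
record, Bałaban AS PRINTED; nothing continuum ∕ ℝ⁴ ∕ OS ∕ mass gap ∕ Clay.  No `sorry`, standard axioms.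
-/

noncomputable section

namespace Summit.QuantumFields.YangMills.BalabanUVNodes.N08Thm2AtRecordLevelZero

open Literature.MathematicalPhysics.QuantumFieldTheory.Balaban1983to89
open Literature.MathematicalPhysics.QuantumFieldTheory.Balaban1983to89.Node00 (SU TFamily₃)
open Literature.MathematicalPhysics.QuantumFieldTheory.Balaban1983to89.B10RunsOfRecord
open Literature.MathematicalPhysics.QuantumFieldTheory.Balaban1985CMP102
open Literature.MathematicalPhysics.QuantumFieldTheory.Balaban1985CMP102.Setting
open Literature.MathematicalPhysics.QuantumFieldTheory.Balaban1985CMP102.Theorems (Family)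
open Summit.QuantumFields.Balaban3D.Proofs

/-! ## §1 Print's backgrounds of record AT LEVEL 0: the [7]-minimiser idiom along any averaging, where `Ū⁰ = id` -/
section LevelZeroBackgrounds
variable {P : Params} {G : Type*} [GaugeGroup G]

/-- **[7]'s variational problem at level 0 is trivial** (`Averaging.iter av 0 = id`): `U₀` is a minimiser on `{U : Ū⁰ = V}` in `reg` iff `U₀ = V ∈ reg`.
[cite: Balaban1985Variational, Thm 1 p.279 (the constraint (3) at k = 0; bookkeeping)] -/
theorem isBackground_zero_iff (av : ∀ j, Averaging P j G) (reg : Set (GaugeField P 0 G)) (V U₀ : GaugeField P 0 G) :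
    IsBackground av reg 0 V U₀ ↔ U₀ = V ∧ V ∈ reg := by
  unfold IsBackground
  have h0 : ∀ U : GaugeField P 0 G, Averaging.iter av 0 U = U := fun _ => rfl
  refine ⟨fun ⟨h1, h2, _⟩ => ⟨(h0 U₀).symm.trans h1, ((h0 U₀).symm.trans h1) ▸ h2⟩, fun ⟨h1, hV⟩ => ?_⟩
  subst h1
  exact ⟨h0 _, hV, fun U _ hU => by rw [← (h0 U).symm.trans hU]⟩

variable (N : ℕ) [NeZero N] {L : ℕ} (𝔞 : ∀ S : Scales L, ∀ j, Averaging S.P j (SU N)) (S : Scales L) (εbg : ℝ)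
  (V : GaugeField S.P 0 (SU N))

/-- **[7]'s existence clause at level 0 along any averaging `𝔞`** (`B10RunsOfRecord.UkExistsA`): solvable iff `V` lies in the regular class
`bgReg3 N S 0 εbg = {PlaqSmall (εbg·η₀²)}`. [cite: Balaban1985Variational, Thm 1 p.279 + (2) p.278 (at k = 0; bookkeeping)] -/
theorem ukExistsA_zero_iff : UkExistsA N 𝔞 S 0 εbg V ↔ PlaqSmall (εbg * S.eta 0 ^ 2) V := by
  unfold UkExistsA
  constructor
  · rintro ⟨U₀, hU₀⟩
    exact ((isBackground_zero_iff (𝔞 S) _ V U₀).1 hU₀).2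
  · intro hV
    exact ⟨V, (isBackground_zero_iff (𝔞 S) _ V V).2 ⟨rfl, hV⟩⟩

/-- **`U₀(V) = V` ON [7]'s class** for print's backgrounds along `𝔞` (`B10RunsOfRecord.UkA`, def-B's `Classical.choose` idiom: the chosen minimiser of
the level-0 problem IS `V`). [cite: Balaban1985UV3, (5) p.256 L35–36; Balaban1985Variational, Thm 1 p.279 (at k = 0)] -/
theorem ukA_zero_of_plaqSmall (h : PlaqSmall (εbg * S.eta 0 ^ 2) V) : UkA N 𝔞 S 0 εbg V = V :=
  ((isBackground_zero_iff (𝔞 S) _ V _).1 (isBackground_UkA N 𝔞 ((ukExistsA_zero_iff N 𝔞 S εbg V).2 h))).1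

/-- **`U₀(V) = 1` OFF [7]'s class** for print's backgrounds along `𝔞` (the documented junk default of the idiom). [cite: Balaban1985UV3, (5) p.256 L35–36; Balaban1985Variational, Thm 1 p.279 (at k = 0; bookkeeping)] -/
theorem ukA_zero_of_not_plaqSmall (h : ¬ PlaqSmall (εbg * S.eta 0 ^ 2) V) : UkA N 𝔞 S 0 εbg V = 1 :=
  UkA_of_not N 𝔞 fun hex => h ((ukExistsA_zero_iff N 𝔞 S εbg V).1 hex)

/-- The instance `𝔞 := avOfPrint N` (print's averaging (2)): `UkExists3` at level 0 iff `V` is in the class. [cite: Balaban1985Variational, Thm 1 p.279 (at k = 0)] -/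
theorem ukExists3_zero_iff : UkExists3 N S 0 εbg V ↔ PlaqSmall (εbg * S.eta 0 ^ 2) V :=
  ukExistsA_zero_iff N (avOfPrint N) S εbg V

/-- `Uk3 N S 0 εbg V = V` on [7]'s class (print's own backgrounds `Backgrounds.ofPrint` at level 0). [cite: Balaban1985UV3, (5) p.256 L35–36 (at k = 0)] -/
theorem uk3_zero_of_plaqSmall (h : PlaqSmall (εbg * S.eta 0 ^ 2) V) : Uk3 N S 0 εbg V = V :=
  ((isBackground_zero_iff (avOfPrint N S) _ V _).1 (isBackground_Uk3 N ((ukExists3_zero_iff N S εbg V).2 h))).1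

/-- `Uk3 N S 0 εbg V = 1` off [7]'s class. [cite: Balaban1985UV3, (5) p.256 L35–36 (at k = 0; bookkeeping)] -/
theorem uk3_zero_of_not_plaqSmall (h : ¬ PlaqSmall (εbg * S.eta 0 ^ 2) V) : Uk3 N S 0 εbg V = 1 :=
  Uk3_of_not N fun hex => h ((ukExists3_zero_iff N S εbg V).1 hex)

/-- The unit configuration is in every class of positive radius (`1(∂p) = 1`, `|1 − 1| = 0`). [cite: Balaban1985Variational, (2) p.278 (bookkeeping)] -/
theorem plaqSmall_one {j : ℕ} {δ : ℝ} (hδ : 0 < δ) : PlaqSmall δ (1 : GaugeField S.P j (SU N)) := fun p => by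
  rw [show GaugeField.plaqHol (1 : GaugeField S.P j (SU N)) p = 1 by
    simp [GaugeField.plaqHol, show ∀ b, (1 : GaugeField S.P j (SU N)) b = 1 from fun _ => rfl], GaugeGroup.dist1_one]
  exact hδ

/-- **The lane's `hU0 : U₀ = id` FAILS at the record's binders off the class** (`εbg > 0`): there `U₀(V) = 1 ≠ V`. [cite: Balaban1985UV3, (5) p.256 L35–36 (at k = 0)] -/
theorem ukA_zero_ne_self (hε : 0 < εbg) (h : ¬ PlaqSmall (εbg * S.eta 0 ^ 2) V) : UkA N 𝔞 S 0 εbg V ≠ V := by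
  rw [ukA_zero_of_not_plaqSmall N 𝔞 S εbg V h]
  exact fun h1 => h (h1 ▸ plaqSmall_one N S (mul_pos hε (by rw [Step0Tower.eta_zero]; norm_num)))

/-- The level-0 class radius is `εbg` itself (`η₀ = L⁰ = 1`). [cite: Balaban1985Variational, (2) p.278 (at k = 0; bookkeeping)] -/
theorem plaqSmall_eta_zero_iff : PlaqSmall (εbg * S.eta 0 ^ 2) V ↔ PlaqSmall εbg V := by
  rw [Step0Tower.eta_zero, one_pow, mul_one]
end LevelZeroBackgrounds

/-! ## §2 (41)₀ and (47)₀ for tower objects extending the record's binders -/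
section LevelZeroIneqs
variable {N : ℕ} [NeZero N] {L : ℕ} {𝔞 : ∀ S : Scales L, ∀ j, Averaging S.P j (SU N)}
  {𝔗 : ∀ S : Scales L, ∀ j, RTOpI S.P j (SU N) (𝔞 S j)} {c : Consts L} {S : Scales L}
  {W : SectB.TowerObjects S (SU N)}

/-- Small-field on all plaquettes is small-field (the `Set.univ` form (4) uses). [cite: Balaban1985UV3, (4) p.256 (bookkeeping)] -/
private theorem plaqSmallOn_univ_iff' {j : ℕ} (δ : ℝ) (U : GaugeField S.P j (SU N)) :
    PlaqSmallOn Set.univ δ U ↔ PlaqSmall δ U := by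
  simp [PlaqSmallOn, PlaqSmall]

/-- The characteristic function (4) is `1` on its window and `0` off it. [cite: Balaban1985UV3, (4) p.256] -/
private theorem chiSmall_univ_of_plaqSmall {j : ℕ} {δ : ℝ} {U : GaugeField S.P j (SU N)} (h : PlaqSmall δ U) :
    chiSmall Set.univ δ U = 1 := by
  unfold chiSmall; rw [if_pos ((plaqSmallOn_univ_iff' δ U).2 h)]

/-- (see `chiSmall_univ_of_plaqSmall`) [cite: Balaban1985UV3, (4) p.256] -/
private theorem chiSmall_univ_of_not_plaqSmall {j : ℕ} {δ : ℝ} {U : GaugeField S.P j (SU N)} (h : ¬ PlaqSmall δ U) :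
    chiSmall Set.univ δ U = 0 := by
  unfold chiSmall; rw [if_neg (mt (plaqSmallOn_univ_iff' δ U).1 h)]

/-- `A^η` at level 0 IS the Wilson action `A` (`η₀ = 1`; (1) vs (5) p. 256). [cite: Balaban1985UV3, (1) + (5) p.256 (bookkeeping)] -/
theorem actionEta_zero (U : GaugeField S.P 0 (SU N)) : S.actionEta 0 U = wilsonAction4 U := by
  unfold Scales.actionEta wilsonAction4
  rw [Step0Tower.eta_zero, inv_one]

/-- `A(1) = 0` for the unit configuration of `GaugeField`. [cite: Balaban1985UV3, (1) p.256 (bookkeeping)] -/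
theorem wilsonAction4_unit {j : ℕ} : wilsonAction4 (1 : GaugeField S.P j (SU N)) = 0 :=
  B10Eq2DensityTower.wilsonAction4_one

/-- The binders of tower objects extending the record's: `U_k = UkA N 𝔞 S k c.εbg`. [cite: Balaban1985UV3, (5) p.256 L35–36 (bookkeeping)] -/
theorem uk_eq_ukA (hW : W.toRunObjects = runObjects₀A N 𝔞 𝔗 (Backgrounds.ofAvg N L 𝔞) c S) (k : ℕ) (V : GaugeField S.P k (SU N)) :
    W.Uk k V = UkA N 𝔞 S k c.εbg V :=
  congrFun (congrFun (congrArg RunObjects.Uk hW) k) V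

/-- … `ε₁ = ε₁` of print ((7) read at step k). [cite: Balaban1985UV3, (7) p.257 (bookkeeping)] -/
theorem eps1_eq (hW : W.toRunObjects = runObjects₀A N 𝔞 𝔗 (Backgrounds.ofAvg N L 𝔞) c S) (k : ℕ) :
    W.ε₁ k = eps1OfPrint c S k :=
  congrFun (congrArg RunObjects.ε₁ hW) k

/-- **(1) p. 256 on the pinned tower run**: `ρ₀(U) = exp[−g₀⁻²A(U) − E₀]`, `E₀ = E` ((64), `E_eq`) — EVERY `W`, no hypothesis on `U₀`. [cite: Balaban1985UV3, (1) p.256] -/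
theorem rho_pin_zero (W : SectB.TowerObjects S (SU N)) (U : GaugeField S.P 0 (SU N)) :
    W.pin.toTowerRun.ρ 0 U = Real.exp (-((S.gk 0)⁻¹ ^ 2 * wilsonAction4 U) - W.pin.toTowerRun.Ecst 0) := by
  show W.pin.rho 0 U = Real.exp (-((S.gk 0)⁻¹ ^ 2 * wilsonAction4 U) - B10.Ek W.Estep S.K 0)
  rw [Step0Tower.gk_zero_inv_sq, ← W.E_eq]
  show Real.exp (-(1 / S.g0sq) * wilsonAction4 U - W.toRunObjects.E) = _
  congr 1
  ring

/-- The main term of the trivial history at level 0 is `g₀⁻²·A(U₀(U))` with `U₀ = UkA N 𝔞 S 0 c.εbg`. [cite: Balaban1985UV3, (41) p.266 + (5) p.256 (at k = 0)] -/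
theorem mainT_pin_zero_triv (hW : W.toRunObjects = runObjects₀A N 𝔞 𝔗 (Backgrounds.ofAvg N L 𝔞) c S) (U : GaugeField S.P 0 (SU N)) :
    W.pin.toTowerRun.mainT 0 (W.pin.toTowerRun.triv 0) U = (S.gk 0)⁻¹ ^ 2 * wilsonAction4 (UkA N 𝔞 S 0 c.εbg U) := by
  show (S.gk 0)⁻¹ ^ 2 * S.actionEta 0 (W.UkH 0 (W.triv 0) U) = _
  rw [actionEta_zero, W.UkH_triv, uk_eq_ukA hW]

/-- The remainder sum of (41)∕(47) is empty at level 0. [cite: Balaban1985UV3, (41) p.266 (bookkeeping)] -/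
theorem rm_pin_zero (W : SectB.TowerObjects S (SU N)) : W.pin.toTowerRun.Rm 0 = 0 := by
  show W.pin.Rm 0 = 0
  unfold SectB.TowerObjects.Rm
  rw [Finset.range_zero, Finset.sum_empty]

/-- The characteristic function of the pinned tower run at level 0 is (4) with threshold `ε₁(0)` of print. [cite: Balaban1985UV3, (4) p.256 + (7) p.257] -/
theorem chi_pin_zero (hW : W.toRunObjects = runObjects₀A N 𝔞 𝔗 (Backgrounds.ofAvg N L 𝔞) c S) (U : GaugeField S.P 0 (SU N)) :
    W.pin.toTowerRun.χ 0 U = chiSmall Set.univ (eps1OfPrint c S 0) U := by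
  show chiSmall Set.univ (W.ε₁ 0) U = _
  rw [eps1_eq hW]

/-- **(41) AT LEVEL 0 HOLDS FOR EVERY CONFIGURATION at the record's binders**, for any extending tower objects with `exp (F triv) ≤ LF 0 V F` (the lane's
`Step0Data.lf_triv`) and (43)@0: on [7]'s class `U₀(V) = V`, off it `U₀(V) = 1` and `A(1) = 0 ≤ A(V)`. [cite: Balaban1985UV3, (41) p.266 + (1) p.256] -/
theorem ineq41_zero (hW : W.toRunObjects = runObjects₀A N 𝔞 𝔗 (Backgrounds.ofAvg N L 𝔞) c S)
    (hP0 : ∀ (h : W.Hist 0) (V : GaugeField S.P 0 (SU N)), W.Pint 0 h V = 0)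
    (hLF : ∀ (V : GaugeField S.P 0 (SU N)) (F : W.Hist 0 → ℝ), Real.exp (F (W.triv 0)) ≤ W.LF 0 V F) :
    B10.Ineq41 W.pin.toTowerRun 0 := by
  intro V
  refine le_trans ?_ (hLF V _)
  show W.pin.toTowerRun.ρ 0 V ≤ Real.exp (-(W.pin.toTowerRun.mainT 0 (W.pin.toTowerRun.triv 0) V) +
    W.pin.toTowerRun.Pint 0 (W.pin.toTowerRun.triv 0) V - W.pin.toTowerRun.Ecst 0 +
    W.pin.toTowerRun.Zterm 0 (W.pin.toTowerRun.triv 0) + W.pin.toTowerRun.Rm 0)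
  rw [rho_pin_zero, mainT_pin_zero_triv hW, W.pin.toTowerRun.Zterm_triv 0, rm_pin_zero,
    show W.pin.toTowerRun.Pint 0 (W.pin.toTowerRun.triv 0) V = 0 from hP0 _ V]
  apply Real.exp_le_exp.mpr
  have hg : 0 ≤ (S.gk 0)⁻¹ ^ 2 := sq_nonneg _
  have hA : wilsonAction4 (UkA N 𝔞 S 0 c.εbg V) ≤ wilsonAction4 V := by
    by_cases hV : PlaqSmall (c.εbg * S.eta 0 ^ 2) V
    · rw [ukA_zero_of_plaqSmall N 𝔞 S c.εbg V hV]
    · rw [ukA_zero_of_not_plaqSmall N 𝔞 S c.εbg V hV, wilsonAction4_unit]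
      exact wilsonAction4_nonneg V
  nlinarith [mul_le_mul_of_nonneg_left hA hg]

/-- **(47) AT LEVEL 0 ⟺ THE WINDOW CONDITION** at the record's binders ((43)@0): (47)₀ iff every NON-FLAT configuration of the (4)-window
`|V(∂p) − 1| < ε₁(0) = g₀p(g₀)` lies in [7]'s level-0 class `|V(∂p) − 1| < εbg·η₀²` (⟸: on the class `U₀(V) = V`, a flat `V` has `A(V) = 0 = A(1)`;
⟹: a non-flat `V` off the class would need `exp(−E) ≤ exp(−g₀⁻²A(V) − E)`).  A LOCATED side condition on the ∃-constants, absent from `Consts.Adm`,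
never met by print ((1) has no `U₀`). [cite: Balaban1985UV3, (47) p.267 + (1), (4) p.256 + (7) p.257] -/
theorem ineq47_zero_iff_window (hW : W.toRunObjects = runObjects₀A N 𝔞 𝔗 (Backgrounds.ofAvg N L 𝔞) c S)
    (hP0 : ∀ (h : W.Hist 0) (V : GaugeField S.P 0 (SU N)), W.Pint 0 h V = 0) :
    B10.Ineq47 W.pin.toTowerRun 0 ↔
      ∀ V : GaugeField S.P 0 (SU N), PlaqSmall (eps1OfPrint c S 0) V → 0 < wilsonAction4 V → PlaqSmall (c.εbg * S.eta 0 ^ 2) V := by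
  have hg : 0 < (S.gk 0)⁻¹ ^ 2 := pow_pos (inv_pos.mpr (ScalesArithmetic.gk_pos S 0)) 2
  -- the printed inequality at one configuration, unfolded
  have key : ∀ V : GaugeField S.P 0 (SU N),
      (W.pin.toTowerRun.χ 0 V * Real.exp (-(W.pin.toTowerRun.mainT 0 (W.pin.toTowerRun.triv 0) V) +
          W.pin.toTowerRun.Pint 0 (W.pin.toTowerRun.triv 0) V - W.pin.toTowerRun.Ecst 0 - W.pin.toTowerRun.Rm 0) ≤
        W.pin.toTowerRun.ρ 0 V) ↔
      (chiSmall Set.univ (eps1OfPrint c S 0) V *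
          Real.exp (-((S.gk 0)⁻¹ ^ 2 * wilsonAction4 (UkA N 𝔞 S 0 c.εbg V)) - W.pin.toTowerRun.Ecst 0) ≤
        Real.exp (-((S.gk 0)⁻¹ ^ 2 * wilsonAction4 V) - W.pin.toTowerRun.Ecst 0)) := by
    intro V
    rw [chi_pin_zero hW, mainT_pin_zero_triv hW, rm_pin_zero, rho_pin_zero,
      show W.pin.toTowerRun.Pint 0 (W.pin.toTowerRun.triv 0) V = 0 from hP0 _ V, add_zero, sub_zero]
  constructor
  · intro h47 V hwin hA
    by_contra hV
    have h := (key V).1 (h47 V)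
    rw [chiSmall_univ_of_plaqSmall hwin, one_mul, ukA_zero_of_not_plaqSmall N 𝔞 S c.εbg V hV, wilsonAction4_unit, mul_zero] at h
    have h' := Real.exp_le_exp.mp h
    nlinarith [mul_pos hg hA]
  · intro hwin V
    refine (key V).2 ?_
    by_cases hV : PlaqSmall (eps1OfPrint c S 0) V
    · rw [chiSmall_univ_of_plaqSmall hV, one_mul]
      apply Real.exp_le_exp.mpr
      by_cases hreg : PlaqSmall (c.εbg * S.eta 0 ^ 2) V
      · rw [ukA_zero_of_plaqSmall N 𝔞 S c.εbg V hreg]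
      · -- off the class the configuration must be flat
        have hA0 : wilsonAction4 V = 0 := by
          by_contra hne
          exact hreg (hwin V hV (lt_of_le_of_ne (wilsonAction4_nonneg V) (Ne.symm hne)))
        rw [ukA_zero_of_not_plaqSmall N 𝔞 S c.εbg V hreg, wilsonAction4_unit, hA0]
    · rw [chiSmall_univ_of_not_plaqSmall hV, zero_mul]
      exact Real.exp_nonneg _

/-- **(47)₀ FROM THE PLAIN WINDOW INCLUSION** `PlaqSmall (ε₁ 0) ⊆ PlaqSmall (εbg·η₀²)`. [cite: Balaban1985UV3, (47) p.267 + (4) p.256 + (7) p.257] -/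
theorem ineq47_zero_of_window (hW : W.toRunObjects = runObjects₀A N 𝔞 𝔗 (Backgrounds.ofAvg N L 𝔞) c S)
    (hP0 : ∀ (h : W.Hist 0) (V : GaugeField S.P 0 (SU N)), W.Pint 0 h V = 0)
    (hwin : ∀ V : GaugeField S.P 0 (SU N), PlaqSmall (eps1OfPrint c S 0) V → PlaqSmall (c.εbg * S.eta 0 ^ 2) V) :
    B10.Ineq47 W.pin.toTowerRun 0 :=
  (ineq47_zero_iff_window hW hP0).2 fun V hV _ => hwin V hV

/-- **THE NECESSITY**: if (47)₀ holds at the record's binders then every non-flat configuration of the (4)-window is [7]-regular at level 0.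
[cite: Balaban1985UV3, (47) p.267 + (4) p.256 (the located side condition)] -/
theorem window_of_ineq47_zero (hW : W.toRunObjects = runObjects₀A N 𝔞 𝔗 (Backgrounds.ofAvg N L 𝔞) c S)
    (hP0 : ∀ (h : W.Hist 0) (V : GaugeField S.P 0 (SU N)), W.Pint 0 h V = 0) (h47 : B10.Ineq47 W.pin.toTowerRun 0)
    (V : GaugeField S.P 0 (SU N)) (hV : PlaqSmall (eps1OfPrint c S 0) V) (hA : 0 < wilsonAction4 V) :
    PlaqSmall (c.εbg * S.eta 0 ^ 2) V :=
  (ineq47_zero_iff_window hW hP0).1 h47 V hV hA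

/-- **`LeafSystem.step0` AT THE RECORD'S BINDERS**: (41)₀ ∧ (47)₀ (`B10.Step0Printed W.pin.toTowerRun`) from the window inclusion, the empty k = 0
interaction sum and the k = 0 history functional dominating its trivial term. [cite: Balaban1985UV3, (1) p.256 + (41) p.266 + (47) p.267] -/
theorem step0_of_window (hW : W.toRunObjects = runObjects₀A N 𝔞 𝔗 (Backgrounds.ofAvg N L 𝔞) c S)
    (hP0 : ∀ (h : W.Hist 0) (V : GaugeField S.P 0 (SU N)), W.Pint 0 h V = 0)
    (hLF : ∀ (V : GaugeField S.P 0 (SU N)) (F : W.Hist 0 → ℝ), Real.exp (F (W.triv 0)) ≤ W.LF 0 V F)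
    (hwin : ∀ V : GaugeField S.P 0 (SU N), PlaqSmall (eps1OfPrint c S 0) V → PlaqSmall (c.εbg * S.eta 0 ^ 2) V) :
    B10.Step0Printed W.pin.toTowerRun :=
  ⟨ineq41_zero hW hP0 hLF, ineq47_zero_of_window hW hP0 hwin⟩
end LevelZeroIneqs

/-! ## §3 The window from the constants: `g·p(g) ≤ b₀p₀^{p₀}e^{1−p₀}` on (0, 1] and `g₀ ≤ 1` along the family -/
section Window
/-- **Monotonicity of the small-field predicate in the threshold.** [cite: Balaban1985UV3, (4) p.256 (bookkeeping)] -/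
theorem plaqSmall_mono {P : Params} {G : Type*} [GaugeGroup G] {j : ℕ} {δ δ' : ℝ} (hδ : δ ≤ δ') {U : GaugeField P j G}
    (h : PlaqSmall δ U) : PlaqSmall δ' U :=
  fun p => lt_of_lt_of_le (h p) hδ

/-- **`g·p(g) ≤ b₀·p₀^{p₀}·e^{1−p₀}` for `0 < g ≤ 1`, `b₀ ≥ 0`, `p₀ > 0`** (the window (7) is bounded on (0, 1]; `B10.rpow_mul_exp_neg_le` with `q = p₀`,
`c = 1`, `u = log g⁻¹`). [cite: Balaban1985UV3, (7) p.257] -/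
theorem mul_pFun_le (b₀ p₀ g : ℝ) (hb : 0 ≤ b₀) (hp : 0 < p₀) (hg : 0 < g) (hg1 : g ≤ 1) :
    g * B10.pFun b₀ p₀ g ≤ b₀ * (p₀ ^ p₀ * Real.exp (1 - p₀)) := by
  have hu : 0 ≤ Real.log g⁻¹ := B10.log_inv_nonneg_of_le_one hg hg1
  have hcore := B10.rpow_mul_exp_neg_le p₀ 1 (Real.log g⁻¹) hp one_pos (by linarith)
  rw [div_one, one_mul] at hcore
  have hgexp : g = Real.exp (-Real.log g⁻¹) := by
    rw [Real.log_inv, neg_neg, Real.exp_log hg]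
  calc g * B10.pFun b₀ p₀ g = b₀ * ((1 + Real.log g⁻¹) ^ p₀ * Real.exp (-Real.log g⁻¹)) := by
        unfold B10.pFun; rw [← hgexp]; ring
    _ ≤ b₀ * (p₀ ^ p₀ * Real.exp (1 - p₀)) := mul_le_mul_of_nonneg_left hcore hb

variable {L : ℕ}

/-- **`ε₁(0) ≤ b₀·p₀^{p₀}·e^{1−p₀}` at every lattice approximation** (`g₀ ≤ g_K ≤ 1` by the spine's `Scales.gK_le_one`), for `b₀ ≥ 0`, `p₀ > 0`.
[cite: Balaban1985UV3, (7) p.257 + p.256 L15–18] -/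
theorem eps1OfPrint_zero_le (c : Consts L) (hb : 0 ≤ c.b₀) (hp : 0 < c.p₀) (S : Scales L) :
    eps1OfPrint c S 0 ≤ c.b₀ * (c.p₀ ^ c.p₀ * Real.exp (1 - c.p₀)) :=
  mul_pFun_le c.b₀ c.p₀ (S.gk 0) hb hp (ScalesArithmetic.gk_pos S 0) (ScalesArithmetic.gk_le_one S S.gK_le_one 0 (Nat.zero_le _))

variable {N : ℕ} [NeZero N]

/-- **THE WINDOW FROM THE CONSTANTS**: `b₀·p₀^{p₀}·e^{1−p₀} ≤ εbg` (`b₀ ≥ 0`, `p₀ > 0`) puts the level-0 (4)-window inside [7]'s level-0 class at EVERY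
lattice approximation. [cite: Balaban1985UV3, (4) p.256 + (7) p.257; Balaban1985Variational, (2) p.278] -/
theorem window_of_consts (c : Consts L) (hb : 0 ≤ c.b₀) (hp : 0 < c.p₀) (hε : c.b₀ * (c.p₀ ^ c.p₀ * Real.exp (1 - c.p₀)) ≤ c.εbg)
    (S : Scales L) (V : GaugeField S.P 0 (SU N)) (hV : PlaqSmall (eps1OfPrint c S 0) V) : PlaqSmall (c.εbg * S.eta 0 ^ 2) V := by
  rw [plaqSmall_eta_zero_iff]
  exact plaqSmall_mono ((eps1OfPrint_zero_le c hb hp S).trans hε) hV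

/-- Admissible constants have `b₀ ≥ 0` and `p₀ > 0` (from `0 < b₀`, `2 < p₀`). [cite: Balaban1985UV3, (7) p.257 (bookkeeping)] -/
theorem b₀_nonneg_and_p₀_pos_of_adm (c : Consts L) (hc : c.Adm) : 0 ≤ c.b₀ ∧ 0 < c.p₀ :=
  ⟨hc.2.1.le, by linarith [hc.2.2.1]⟩

/-- **NON-VACUITY of §3's hypotheses (cell rule A6)**: admissible constants meeting the window bound exist (`b₀ = 1`, `p₀ = 3`, `εbg = 4 ≥ 27e⁻²`;
`ε₀`, `E` the documented junk of `Consts.junk`). [cite: Balaban1985UV3, (7) p.257 + p.256 L15–18 (bookkeeping)] -/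
theorem exists_consts_adm_window (L : ℕ) : ∃ c : Consts L, c.Adm ∧ c.b₀ * (c.p₀ ^ c.p₀ * Real.exp (1 - c.p₀)) ≤ c.εbg := by
  refine ⟨{ Consts.junk L with εbg := 4 }, ?_, ?_⟩
  · obtain ⟨h1, h2, h3, -⟩ := Consts.junk_adm L
    exact ⟨h1, h2, h3, by show (0 : ℝ) < 4; norm_num⟩
  · show (1 : ℝ) * ((3 : ℝ) ^ (3 : ℝ) * Real.exp (1 - 3)) ≤ 4
    have h3 : (3 : ℝ) ^ (3 : ℝ) = 27 := by
      rw [show (3 : ℝ) = ((3 : ℕ) : ℝ) by norm_num, Real.rpow_natCast]; norm_num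
    have he : Real.exp (1 - 3) * (Real.exp 1 * Real.exp 1) = 1 := by
      rw [← Real.exp_add, ← Real.exp_add]; norm_num
    have h1 := Real.exp_one_gt_d9
    rw [h3, one_mul]
    nlinarith [Real.exp_pos (1 - 3), mul_pos (Real.exp_pos 1) (Real.exp_pos 1)]

variable {𝔞 : ∀ S : Scales L, ∀ j, Averaging S.P j (SU N)} {𝔗 : ∀ S : Scales L, ∀ j, RTOpI S.P j (SU N) (𝔞 S j)}
  {c : Consts L} {S : Scales L} {W : SectB.TowerObjects S (SU N)}

/-- **(41)₀ ∧ (47)₀ AT THE RECORD'S BINDERS FROM THE CONSTANTS**: with `b₀·p₀^{p₀}·e^{1−p₀} ≤ εbg` every tower objects extending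
`runObjects₀A N 𝔞 𝔗 (Backgrounds.ofAvg N L 𝔞) c S` with print's k = 0 data satisfy `B10.Step0Printed` — at every member `S` of the family at once.
[cite: Balaban1985UV3, (1) p.256 + (41) p.266 + (47) p.267 + (7) p.257] -/
theorem step0_of_consts (hW : W.toRunObjects = runObjects₀A N 𝔞 𝔗 (Backgrounds.ofAvg N L 𝔞) c S) (hb : 0 ≤ c.b₀) (hp : 0 < c.p₀)
    (hε : c.b₀ * (c.p₀ ^ c.p₀ * Real.exp (1 - c.p₀)) ≤ c.εbg)
    (hP0 : ∀ (h : W.Hist 0) (V : GaugeField S.P 0 (SU N)), W.Pint 0 h V = 0)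
    (hLF : ∀ (V : GaugeField S.P 0 (SU N)) (F : W.Hist 0 → ℝ), Real.exp (F (W.triv 0)) ≤ W.LF 0 V F) :
    B10.Step0Printed W.pin.toTowerRun :=
  step0_of_window hW hP0 hLF (window_of_consts c hb hp hε S)
end Window

/-! ## §4 The strength of the record's Thm-2 conjunct: (5) in the compact reading, RUN BY RUN -/
section Strength
variable (N : ℕ) [NeZero N] {L : ℕ} (R₀ : Consts L → ∀ S : Scales L, RunObjects S (SU N)) (c : Consts L)

/-- **Per-run data give (5) in the compact reading for that run** (one-member family `fun _ : Unit => (withReprSlot N R₀ c S).toRunData`; Sect. D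
«(41), (47) ⇒ (5)» via `B10Assembly.thm1Compact_and_thm2_of_leafSystem` + `bounds5At_pin_iff_of_eqG`; the O(1) depends on THIS run's leaf constants).
[cite: Balaban1985UV3, Sect. D pp.272–275 + Thm 1 p.257 (compact reading)] -/
theorem thm1Compact_single_of_leafSystem {S : Scales L} {C : B10Assembly.Consts} (W : SectB.TowerObjects S (SU N)) (hW : W.toRunObjects = R₀ c S)
    (LS : B10Assembly.LeafSystem C W.pin.toTowerRun) :
    B10.Thm1PrintedCompact (fun _ : Unit => (withReprSlot N R₀ c S).toRunData) := by
  have h := (B10Assembly.thm1Compact_and_thm2_of_leafSystem (fun _ : Unit => W.pin.toTowerRun) (fun _ => LS)).1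
  intro gmin gmax hmin hle
  obtain ⟨O1, hO1⟩ := h gmin gmax hmin hle
  exact ⟨O1, fun u k hk h1 h2 => (bounds5At_pin_iff_of_eqG N R₀ c W hW O1 k).1 (hO1 u k hk h1 h2)⟩

/-- **The ∃-representation reading at any one step already gives (5)-compact for the run** (its leaf system does). [cite: Balaban1985UV3, Thm 2 p.272 + Sect. D pp.272–275] -/
theorem thm1Compact_single_of_repr41_47G {S : Scales L} {k : ℕ} (h : Repr41_47G N R₀ c S k) :
    B10.Thm1PrintedCompact (fun _ : Unit => (withReprSlot N R₀ c S).toRunData) := by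
  obtain ⟨C, W, hW, ⟨LS⟩, -, -⟩ := h
  exact thm1Compact_single_of_leafSystem N R₀ c W hW LS

/-- **THE RECORD'S Thm-2 CONJUNCT ALONE ⇒ Thm 1 (compact reading) FOR EACH RUN SEPARATELY** (run-dependent O(1); the Thm-1 conjunct adds exactly its
UNIFORMITY across the family, p. 257 L1 «independent of ε, k»). [cite: Balaban1985UV3, Thm 2 p.272 + Thm 1 p.257 + Sect. D pp.272–275] -/
theorem thm1Compact_single_of_thm2Printed_runsAtG (h : B10.Thm2Printed (runsAtG N R₀ c)) (S : Family L c.eps0) :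
    B10.Thm1PrintedCompact (fun _ : Unit => runsAtG N R₀ c S) :=
  thm1Compact_single_of_repr41_47G N R₀ c (h S 0 (Nat.zero_le _))
end Strength

/-! ## §5 The instances at the slot of record (`𝔞 := avOfPrint N`, print's own backgrounds `Backgrounds.ofPrint`, any version `𝔗 : TFamily₃ N L` of (2)) -/
section SlotOfRecord
variable {N : ℕ} [NeZero N] {L : ℕ} {𝔗 : TFamily₃ N L} {c : Consts L} {S : Scales L} {W : SectB.TowerObjects S (SU N)}

/-- **(47)₀ ⟺ window, AT THE SLOT OF RECORD** (print's averaging, print's own [7]-backgrounds `Backgrounds.ofPrint`, any version `𝔗` of (2)).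
[cite: Balaban1985UV3, (47) p.267 + (1), (4) p.256 + (7) p.257] -/
theorem ineq47_zero_iff_window_ofPrint (hW : W.toRunObjects = runObjects₀T N 𝔗 (Backgrounds.ofPrint N L) c S)
    (hP0 : ∀ (h : W.Hist 0) (V : GaugeField S.P 0 (SU N)), W.Pint 0 h V = 0) :
    B10.Ineq47 W.pin.toTowerRun 0 ↔
      ∀ V : GaugeField S.P 0 (SU N), PlaqSmall (eps1OfPrint c S 0) V → 0 < wilsonAction4 V → PlaqSmall (c.εbg * S.eta 0 ^ 2) V :=
  ineq47_zero_iff_window (𝔞 := avOfPrint N) hW hP0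

/-- **`Step0Printed` AT THE SLOT OF RECORD from the constants.** [cite: Balaban1985UV3, (1) p.256 + (41) p.266 + (47) p.267 + (7) p.257] -/
theorem step0_of_consts_ofPrint (hW : W.toRunObjects = runObjects₀T N 𝔗 (Backgrounds.ofPrint N L) c S) (hb : 0 ≤ c.b₀) (hp : 0 < c.p₀)
    (hε : c.b₀ * (c.p₀ ^ c.p₀ * Real.exp (1 - c.p₀)) ≤ c.εbg)
    (hP0 : ∀ (h : W.Hist 0) (V : GaugeField S.P 0 (SU N)), W.Pint 0 h V = 0)
    (hLF : ∀ (V : GaugeField S.P 0 (SU N)) (F : W.Hist 0 → ℝ), Real.exp (F (W.triv 0)) ≤ W.LF 0 V F) :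
    B10.Step0Printed W.pin.toTowerRun :=
  step0_of_consts (𝔞 := avOfPrint N) hW hb hp hε hP0 hLF

end SlotOfRecord
end Summit.QuantumFields.YangMills.BalabanUVNodes.N08Thm2AtRecordLevelZero

end
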